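import Mathlib
import Summits.ValiantsHypothesis.ValiantsHypothesis.Theses.GirthSidon
import Summits.ValiantsHypothesis.ValiantsHypothesis.Theorems.GirthSidonPolySwallowForcesShortRelationTotallyBorn

/-!
# Route GirthSidon — crux `PolySwallowForcesShortRelation` (stmt-ValiantsHypothesis-6537) FOLLOWS from the
totally-born residual alone (sorry-free form of the line `two_ended_honesty` after its two landed halves)

`polySwallow_of_totallyBorn`: the crux `PolySwallowForcesShortRelation` is implied by the single statement
`TB` = "for `m ≥ m₀`, `s^10 ≤ 2^18 m^9`, a quadratic polynomial swallowing `Γ_i(y) = x^{d_i}` all of whose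
targets are TOTALLY BORN (`d_i ∉ (O₀ ∪ O_∞) + (O₀ ∪ O_∞)`, `O₀`/`O_∞` = orders/degrees of the nonzero
elements of `span_ℂ(1,y)`) has a relation of length `≤ 30`" — the registered stub `stub_totallyBornTargets` of
the line with the skeleton's `sourceSpan`/`TotallyBorn` unfolded.  Proof = the line's composition with its
landed pieces: targets covered by `U + U`, `U = O₀ ∪ O_∞` (honest at `0`, cross-honest, honest at `∞`) go to
`Theorems.coveredTargets_relation` (val-width-6537-p1, p576962; equivalently
`PolySwallowTotallyBorn.relation_of_orderDegreeCover`), the rest are totally born; the larger class has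
`m' ≥ m/2` elements and `s^10 ≤ m^9 ≤ 512 m'^9 ≤ 2^18 m'^9`; restriction along `Finset.orderEmbOfFin`.
So the crux item is now EQUIVALENT (up to the constant `2^18`) to its typed residual.  VP ≠ VNP is not moved.
[folklore]
-/

set_option linter.dupNamespace false

namespace Summit.ValiantsHypothesis.ValiantsHypothesis.Theorems

open Polynomial
open Summit.ValiantsHypothesis.ValiantsHypothesis.Theses.GirthSidon

namespace PolySwallowGlue

/-- **Crux ⇐ residual.**  `PolySwallowForcesShortRelation` follows from the totally-born residual statement
(registered stub `stub_totallyBornTargets`, unfolded). [folklore] -/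
theorem polySwallow_of_totallyBorn
    (hTB : ∃ m₀ : ℕ, ∀ m ≥ m₀, ∀ (d : Fin m → ℕ) (s : ℕ), s ^ 10 ≤ 262144 * m ^ 9 →
      ∀ (Γ : Fin m → MvPolynomial (Fin s) ℂ) (y : Fin s → Polynomial ℂ),
        (∀ i, (Γ i).totalDegree ≤ 2) → (∀ i, MvPolynomial.aeval y (Γ i) = Polynomial.X ^ d i) →
        (∀ i, ∀ f ∈ Submodule.span ℂ (insert 1 (Set.range y)),
          ∀ g ∈ Submodule.span ℂ (insert 1 (Set.range y)), f ≠ 0 → g ≠ 0 →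
            d i ≠ f.natTrailingDegree + g.natTrailingDegree ∧
            d i ≠ f.natTrailingDegree + g.natDegree ∧
            d i ≠ f.natDegree + g.natDegree) →
        ∃ S T : Multiset (Fin m), S ≠ T ∧ Multiset.card S ≤ 30 ∧ Multiset.card T ≤ 30 ∧
          (S.map d).sum = (T.map d).sum) :
    PolySwallowForcesShortRelation := by
  classical
  obtain ⟨mB, hB⟩ := hTB
  obtain ⟨mC, hC⟩ := PolySwallowTotallyBorn.relation_of_orderDegreeCover 262144
  refine ⟨2 * (mB + mC), fun m hm d s hs Γ y hΓ hy => ?_⟩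
  -- covered class
  let P : Fin m → Prop := fun i => ∃ f ∈ Submodule.span ℂ (insert 1 (Set.range y)),
    ∃ g ∈ Submodule.span ℂ (insert 1 (Set.range y)), f ≠ 0 ∧ g ≠ 0 ∧
      (d i = f.natTrailingDegree + g.natTrailingDegree ∨
       d i = f.natTrailingDegree + g.natDegree ∨
       d i = f.natDegree + g.natDegree)
  let H : Finset (Fin m) := Finset.univ.filter fun i => P i
  have hcard : H.card + Hᶜ.card = m := by
    rw [Finset.card_compl, Fintype.card_fin]
    have : H.card ≤ m := le_trans (Finset.card_le_univ H) (by simp)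
    omega
  have num : ∀ c : ℕ, m ≤ 2 * c → s ^ 10 ≤ 262144 * c ^ 9 := by
    intro c hc
    calc s ^ 10 ≤ m ^ 9 := hs
      _ ≤ (2 * c) ^ 9 := by gcongr
      _ = 512 * c ^ 9 := by ring
      _ ≤ 262144 * c ^ 9 := by omega
  have restrict : ∀ (I : Finset (Fin m)),
      (∃ S T : Multiset (Fin I.card), S ≠ T ∧ Multiset.card S ≤ 30 ∧ Multiset.card T ≤ 30 ∧
        (S.map (d ∘ (I.orderEmbOfFin rfl).toEmbedding)).sum =
          (T.map (d ∘ (I.orderEmbOfFin rfl).toEmbedding)).sum) →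
      ∃ S T : Multiset (Fin m), S ≠ T ∧ Multiset.card S ≤ 30 ∧ Multiset.card T ≤ 30 ∧
        (S.map d).sum = (T.map d).sum := by
    intro I h
    obtain ⟨S, T, hne, hS, hT, hsum⟩ := h
    let e : Fin I.card ↪ Fin m := (I.orderEmbOfFin rfl).toEmbedding
    refine ⟨S.map e, T.map e, ?_, by simpa using hS, by simpa using hT, ?_⟩
    · exact fun heq => hne (Multiset.map_injective e.injective heq)
    · simpa [Multiset.map_map, e] using hsum
  by_cases hmaj : m ≤ 2 * H.card
  · let e : Fin H.card ↪ Fin m := (H.orderEmbOfFin rfl).toEmbedding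
    have he : ∀ i, e i ∈ H := fun i => H.orderEmbOfFin_mem rfl i
    exact restrict H (hC H.card (by omega) (d ∘ e) s (num H.card hmaj) y fun i =>
      (Finset.mem_filter.mp (he i)).2)
  · let e : Fin Hᶜ.card ↪ Fin m := (Hᶜ.orderEmbOfFin rfl).toEmbedding
    have he : ∀ i, e i ∈ Hᶜ := fun i => Hᶜ.orderEmbOfFin_mem rfl i
    refine restrict Hᶜ (hB Hᶜ.card (by omega) (d ∘ e) s (num Hᶜ.card (by omega)) (Γ ∘ e) y
      (fun i => hΓ (e i)) (fun i => hy (e i)) fun i f hf g hg hf0 hg0 => ?_)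
    have hnP : ¬ P (e i) := fun hP =>
      (Finset.mem_compl.mp (he i)) (Finset.mem_filter.mpr ⟨Finset.mem_univ _, hP⟩)
    exact ⟨fun h => hnP ⟨f, hf, g, hg, hf0, hg0, Or.inl h⟩,
      fun h => hnP ⟨f, hf, g, hg, hf0, hg0, Or.inr (Or.inl h)⟩,
      fun h => hnP ⟨f, hf, g, hg, hf0, hg0, Or.inr (Or.inr h)⟩⟩

end PolySwallowGlue

end Summit.ValiantsHypothesis.ValiantsHypothesis.Theorems
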